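import Literature.NumberTheory.EllipticCurves.KramerTunnell1982.FiniteFieldQuadraticLangProofs
import Literature.NumberTheory.EllipticCurves.KramerTunnell1982.KernelReductionNormProofs
import Literature.NumberTheory.EllipticCurves.PointReduction
import HarnessLib

/-!
# Good reduction, unramified quadratic automorphism: `E(K)^σ = N E(K)` and `H¹(⟨σ⟩, E(K)) = 0`
# (Kramer–Tunnell 1982, Lemma 6.1, type `I₀`: "Lang's theorem")

`Proofs` file (theorems only; no definitions, no named facts) in topic
`NumberTheory/EllipticCurves`, third bottom-up step of the discharge of the named fact
`Literature.NumberTheory.EllipticCurves.KramerTunnell1982.lemma61_unramifiedNormIndex`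
(`KramerTunnell1982/UnramifiedNormIndex.lean`; K. Kramer, J. Tunnell, Compositio Math. 46 (1982),
§6 Lemma 6.1, p. 327).  For good reduction (Kodaira type `I₀`) the Néron identity component is
the whole curve, `E₀ = E`, `n = c = 1`, and the printed proof reduces to its first sentence:

> "It follows from Lang's theorem [9] that `N : E₀(K) → E₀(F)` is surjective. … For reductions of
> type `I₀` … `c` is odd and `n` is odd. Since `X` must be trivial, `dim E(F)/NE(K) = 0`."

This file assembles that statement — and its companion `H¹(G, E(K)) = 0`, implicit in
"`dim E(F)/NE(K) = dim H⁰(G, X)`" — over an **abstract** non-archimedean local field `K` with an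
isometric involution `σ` (the generator of `G = Gal(K/F)`), from the two layers already in the tree:

* the special fibre (`FiniteFieldQuadraticLangProofs`: `H¹ = Ĥ⁰ = 0` for `Gal(k'/k)` acting on
  `Ẽ(k')`, from Lang's theorem `exists_map_frob_sub_eq` and Herbrand), reached through the
  reduction map of `PointReduction` (`reducePoint w r Ṽ`: additive on integral points,
  `reducePoint_add`; kernel `E₁`), Hensel lifts of points of `Ẽ(k')` being supplied as a hypothesis
  (`hhensel`, discharged for a concrete `K` by `WeierstrassCurve.exists_equation_residue_eq`);
* the kernel of reduction (`KernelReductionNormProofs`: `Ĥ⁰ = H¹ = 0` on `E₁(K)` by successive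
  approximation).

Main results (setting: `V = X ⊗ K` a `w`-integral elliptic equation with `|Δ| = 1`; `σ`, `π`, `θ`
as in `KernelReductionNormProofs`; a quadratic extension of finite fields `k'/k` with `τ ≠ 1` in
`Aut(k'/k)`, a residue map `r : 𝒪_w → k'` with kernel `𝔪_w` intertwining `σ` and `τ`, and an
elliptic curve `Ẽ/k` with `Ṽ = Ẽ ⊗ k'`):

* `reducePoint_map_eq` (private) — the reduction map is `σ`/`τ`-equivariant;
* `exists_add_map_eq_of_good` — **`Ĥ⁰(⟨σ⟩, E(K)) = 0`**: every `σ`-fixed `P ∈ E(K)` is `Q + σQ`;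
* `exists_map_sub_eq_of_good` — **`H¹(⟨σ⟩, E(K)) = 0`**: every `P` with `P + σP = O` is `σQ - Q`.

## References

* [KramerTunnell1982] K. Kramer, J. Tunnell, *Elliptic curves and local ε-factors*, Compositio
  Math. 46 (1982) 307–352, §6 Lemma 6.1 and its proof (p. 327).
* [Mazur1972] B. Mazur, Invent. Math. 18 (1972) 183–266, §4 (Cor. 4.4: norms are surjective on
  `A(K)` for good reduction and `K/F` unramified).
* [SilvermanAEC2009] J. H. Silverman, *The Arithmetic of Elliptic Curves*, 2nd ed., VII.2.1
  (`0 → E₁ → E₀ → Ẽ_ns → 0`).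

## Design

No definitions; `noncomputable section`; `open scoped Classical NNReal`; one universe `u` for
`E, K, k, k'`.  The reduction map is `Literature.NumberTheory.EllipticCurves.reducePoint w r Ṽ`
(file `PointReduction`), a bare function additive on integral points; the case analysis
"integral / kernel of reduction" replaces the exact sequence of VII.2.1.
-/

noncomputable section

open scoped Classical NNReal
open ValuativeRel Field
open Literature.NumberTheory.GaloisRepresentations
open Literature.NumberTheory.GaloisRepresentations.IsNonarchimedeanLocalField
open Literature.NumberTheory.EllipticCurves.FormalGroupChart

universe u

namespace Literature.NumberTheory.EllipticCurves.KramerTunnell1982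

/-- `(σ : K →ₐ[E] K) z = σ z` (the coercion `AlgEquiv → AlgHom` on elements). [folklore] -/
private theorem algHom_coe_apply' {E K : Type u} [Field E] [Field K] [Algebra E K]
    (ρ : K ≃ₐ[E] K) (z : K) : (ρ : K →ₐ[E] K) z = ρ z := rfl

section Setting

variable {E : Type u} [Field E] {K : Type u} [Field K] [Algebra E K]
  [ValuativeRel K] [TopologicalSpace K] [IsNonarchimedeanLocalField K]
  (X : WeierstrassCurve E) {w : Valuation K ℝ≥0}
  [hVE : (X.baseChange K).IsElliptic] [hV : (X.baseChange K).IsIntegral w.integer]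
  {σ : K ≃ₐ[E] K} (hσw : ∀ y, w (σ y) = w y)
  {k : Type u} [Field k] {k' : Type u} [Field k'] [Algebra k k']
  (τ : k' ≃ₐ[k] k') (r : w.integer →+* k') (hr : ∀ a : w.integer, r a = 0 ↔ w (a : K) < 1)
  (hrσ : ∀ a a' : w.integer, (a' : K) = σ a → r a' = τ (r a))
  (Ek : WeierstrassCurve k) (hVt : reduceCurve r (X.baseChange K) = Ek.baseChange k')
  (hΔ : w (X.baseChange K).Δ = 1)

/-! ## §1 Integral points and the kernel of reduction -/

omit [ValuativeRel K] [TopologicalSpace K] [IsNonarchimedeanLocalField K] hVE in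
/-- Every point is integral (`O` or `|x| ≤ 1`) or lies in the kernel of reduction `E₁` (`|x| > 1`)
(Silverman, *AEC*, VII.2: `E₁(K)` is `O` together with the affine points with non-integral `x`).
[cite: SilvermanAEC2009, VII.2 (definition of E₁(K), PDF p. 167)] -/
theorem isIntegralPoint_or_mem_kernel (P : (X.baseChange K).toAffine.Point) :
    IsIntegralPoint w P ∨ P ∈ kernel w (X.baseChange K) := by
  rcases P with _ | ⟨x, y, h⟩
  · exact Or.inl isIntegralPoint_zero
  · by_cases hx : w x ≤ 1
    · exact Or.inl hx
    · exact Or.inr (some_mem_kernel h (not_le.mp hx))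

omit [ValuativeRel K] [TopologicalSpace K] [IsNonarchimedeanLocalField K] hVE in
include hr hΔ hVt in
/-- An integral point with reduction `Õ` is `O`; hence a point with reduction `Õ` lies in `E₁`.
(`PointReduction.reducePoint_eq_zero_iff`.) [cite: SilvermanAEC2009, Prop. VII.2.1] -/
theorem mem_kernel_of_reducePoint_eq_zero {P : (X.baseChange K).toAffine.Point}
    (hP : reducePoint w r (Ek.baseChange k') P = 0) : P ∈ kernel w (X.baseChange K) := by
  rcases isIntegralPoint_or_mem_kernel (w := w) X P with hint | hker
  · rw [(reducePoint_eq_zero_iff hr hΔ hVt hint).mp hP]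
    exact (kernel w (X.baseChange K)).zero_mem
  · exact hker

omit [ValuativeRel K] [TopologicalSpace K] [IsNonarchimedeanLocalField K] hVE in
/-- A point of `E₁` reduces to `Õ` (Silverman, *AEC*, Prop. VII.2.1: `E₁ = ker` of reduction).
[cite: SilvermanAEC2009, Prop. VII.2.1] -/
theorem reducePoint_eq_zero_of_mem_kernel {P : (X.baseChange K).toAffine.Point}
    (hP : P ∈ kernel w (X.baseChange K)) : reducePoint w r (Ek.baseChange k') P = 0 := by
  rcases P with _ | ⟨x, y, h⟩
  · rfl
  · exact reducePoint_some_of_one_lt ((some_mem_kernel_iff h).mp hP)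

omit [ValuativeRel K] [TopologicalSpace K] [IsNonarchimedeanLocalField K] hVE in
include hr hΔ hVt in
/-- Two integral points with the same reduction differ by an element of `E₁`
(`reducePoint_add`, `reducePoint_neg`). [cite: SilvermanAEC2009, Prop. VII.2.1] -/
theorem sub_mem_kernel_of_reducePoint_eq {A B : (X.baseChange K).toAffine.Point}
    (hA : IsIntegralPoint w A) (hB : IsIntegralPoint w B)
    (hAB : reducePoint w r (Ek.baseChange k') A = reducePoint w r (Ek.baseChange k') B) :
    A - B ∈ kernel w (X.baseChange K) := by
  refine mem_kernel_of_reducePoint_eq_zero X r hr Ek hVt hΔ ?_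
  rw [sub_eq_add_neg, reducePoint_add hr hΔ hVt hA (isIntegralPoint_neg_iff.mpr hB),
    reducePoint_neg hVt, hAB, add_neg_cancel]

omit [ValuativeRel K] [TopologicalSpace K] [IsNonarchimedeanLocalField K] hVE hV in
include hσw in
/-- `σ` preserves integrality of points. [folklore] -/
private theorem isIntegralPoint_map_iff (P : (X.baseChange K).toAffine.Point) :
    IsIntegralPoint w (WeierstrassCurve.Affine.Point.map (σ : K →ₐ[E] K) P) ↔
      IsIntegralPoint w P := by
  rcases P with _ | ⟨x, y, h⟩
  · exact Iff.rfl
  · rw [WeierstrassCurve.Affine.Point.map_some, isIntegralPoint_some_iff, isIntegralPoint_some_iff,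
      algHom_coe_apply', hσw]

/-! ## §2 Equivariance of the reduction map -/

omit [ValuativeRel K] [TopologicalSpace K] [IsNonarchimedeanLocalField K] hVE in
include hσw hr hrσ hΔ hVt in
/-- **Reduction intertwines `σ` and `τ`**: `ρ(σP) = τ(ρP)` for the reduction map
`ρ = reducePoint w r (Ẽ ⊗ k')`, when `r(σa) = τ(r a)` on `𝒪_w` (for `K/F` unramified quadratic:
the Frobenius of `k_K/k_F` is induced by the generator of `Gal(K/F)`). [folklore] -/
private theorem reducePoint_map_eq (P : (X.baseChange K).toAffine.Point) :
    reducePoint w r (Ek.baseChange k') (WeierstrassCurve.Affine.Point.map (σ : K →ₐ[E] K) P) =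
      WeierstrassCurve.Affine.Point.map (τ : k' →ₐ[k] k')
        (reducePoint w r (Ek.baseChange k') P) := by
  rcases isIntegralPoint_or_mem_kernel (w := w) X P with hint | hker
  · rcases P with _ | ⟨x, y, h⟩
    · rfl
    · have hx : w x ≤ 1 := hint
      have hσx : w (σ x) ≤ 1 := by rw [hσw]; exact hx
      have hy : w y ≤ 1 := val_y_le_one h.1 hx
      have hσy : w (σ y) ≤ 1 := by rw [hσw]; exact hy
      rw [WeierstrassCurve.Affine.Point.map_some, reducePoint_some hr hΔ hVt h hx,
        WeierstrassCurve.Affine.Point.map_some]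
      have hint' : w ((σ : K →ₐ[E] K) x) ≤ 1 := hσx
      rw [reducePoint_some hr hΔ hVt _ hint']
      refine point_some_eq_some ?_ ?_
      · rw [algHom_coe_apply', reduceFun_of_le r hσx, reduceFun_of_le r hx, algHom_coe_apply',
          hrσ ⟨x, hx⟩ ⟨σ x, hσx⟩ rfl]
      · rw [algHom_coe_apply', reduceFun_of_le r hσy, reduceFun_of_le r hy, algHom_coe_apply',
          hrσ ⟨y, hy⟩ ⟨σ y, hσy⟩ rfl]
  · have hσker : WeierstrassCurve.Affine.Point.map (σ : K →ₐ[E] K) P ∈ kernel w (X.baseChange K) :=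
      (map_mem_kernel_iff (X := X) (F := (σ : K →ₐ[E] K)) hσw P).mpr hker
    rw [reducePoint_eq_zero_of_mem_kernel X r Ek hker,
      reducePoint_eq_zero_of_mem_kernel X r Ek hσker, map_zero]

/-! ## §3 Hensel lifts of points of `Ẽ(k')` -/

omit [ValuativeRel K] [TopologicalSpace K] [IsNonarchimedeanLocalField K] hVE in
include hr hΔ hVt in
/-- From a Hensel hypothesis on coordinates to lifts of points: every point of `Ẽ(k')` is the
reduction of an integral point of `E(K)`. [cite: SilvermanAEC2009, Prop. VII.2.1 (surjectivity of reduction)] -/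
theorem exists_reducePoint_eq_of_hensel
    (hhensel : ∀ α β : k', (Ek.baseChange k').toAffine.Nonsingular α β →
      ∃ (x y : K) (_ : (X.baseChange K).toAffine.Nonsingular x y),
        w x ≤ 1 ∧ reduceFun r x = α ∧ reduceFun r y = β)
    (Q : (Ek.baseChange k').toAffine.Point) :
    ∃ P : (X.baseChange K).toAffine.Point, IsIntegralPoint w P ∧
      reducePoint w r (Ek.baseChange k') P = Q := by
  rcases Q with _ | ⟨α, β, hQ⟩
  · exact ⟨0, isIntegralPoint_zero, rfl⟩
  · obtain ⟨x, y, h, hx, hα, hβ⟩ := hhensel α β hQ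
    refine ⟨.some x y h, hx, ?_⟩
    rw [reducePoint_some hr hΔ hVt h hx]
    exact point_some_eq_some hα hβ

end Setting

/-! ## §4 `Ĥ⁰ = 0` and `H¹ = 0` for good reduction -/

section Main

variable {E : Type u} [Field E] {K : Type u} [Field K] [Algebra E K]
  [ValuativeRel K] [TopologicalSpace K] [IsNonarchimedeanLocalField K]
  (X : WeierstrassCurve E) {w : Valuation K ℝ≥0}
  (hw : ∀ a : K, (w a : ℝ) = algNorm K (algebraMap K (AlgebraicClosure K) a))
  [hVE : (X.baseChange K).IsElliptic] [hV : (X.baseChange K).IsIntegral w.integer]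
  (hΔ : w (X.baseChange K).Δ = 1)
  {σ : K ≃ₐ[E] K} (hσw : ∀ y, w (σ y) = w y) (hσσ : ∀ y, σ (σ y) = y)
  {π : K} (hπσ : σ π = π) (hπ0 : 0 < w π) (hπ1 : w π < 1)
  (hdisc : ∀ y : K, w y < 1 → w y ≤ w π)
  {θ : K} (hθ : w θ ≤ 1) (hθt : w (θ + σ θ) = 1)
  {k : Type u} [Field k] [Finite k] {k' : Type u} [Field k'] [Finite k'] [Algebra k k']
  (h2 : Module.finrank k k' = 2) (τ : k' ≃ₐ[k] k') (hτ : τ ≠ 1)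
  (r : w.integer →+* k') (hr : ∀ a : w.integer, r a = 0 ↔ w (a : K) < 1)
  (hrσ : ∀ a a' : w.integer, (a' : K) = σ a → r a' = τ (r a))
  (Ek : WeierstrassCurve k) [Ek.IsElliptic] (hVt : reduceCurve r (X.baseChange K) = Ek.baseChange k')
  (hhensel : ∀ α β : k', (Ek.baseChange k').toAffine.Nonsingular α β →
    ∃ (x y : K) (_ : (X.baseChange K).toAffine.Nonsingular x y),
      w x ≤ 1 ∧ reduceFun r x = α ∧ reduceFun r y = β)

include hσσ in
omit [ValuativeRel K] [TopologicalSpace K] [IsNonarchimedeanLocalField K] hVE hV in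
/-- `σ² = 1` on points. [folklore] -/
private theorem map_map_self' (P : (X.baseChange K).toAffine.Point) :
    WeierstrassCurve.Affine.Point.map (σ : K →ₐ[E] K)
      (WeierstrassCurve.Affine.Point.map (σ : K →ₐ[E] K) P) = P := by
  rw [WeierstrassCurve.Affine.Point.map_map]
  have h : (σ : K →ₐ[E] K).comp (σ : K →ₐ[E] K) = AlgHom.id E K := by
    ext y
    exact hσσ y
  rw [h]
  cases P <;> rfl

include hw hΔ hσw hσσ hπσ hπ0 hπ1 hdisc hθ hθt h2 hτ hr hrσ hVt hhensel in
/-- **`Ĥ⁰(⟨σ⟩, E(K)) = 0` for good reduction: every `σ`-fixed point is a norm** — the type-`I₀`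
case of Kramer–Tunnell's Lemma 6.1 ("It follows from Lang's theorem [9] that
`N : E₀(K) → E₀(F)` is surjective … For reductions of type `I₀` … `dim E(F)/NE(K) = 0`").  For
`V = X ⊗ K` integral with `|Δ| = 1` over the local field `K`, `σ` an isometric involution of `K/E`
with an `E`-side uniformiser `π` (`σπ = π`, `|y| < 1 ⇒ |y| ≤ |π|`) and `θ + σθ` a unit — i.e.
`K/K^σ` unramified quadratic — and residue data `(k'/k, τ, r, Ẽ)` as above: every `P ∈ E(K)` with
`σP = P` is `Q + σQ` for some `Q ∈ E(K)`.  Proof: reduce, apply `Ĥ⁰ = 0` on `Ẽ(k')`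
(`exists_add_map_eq_of_map_eq`), lift by Hensel, and absorb the error in `E₁` (`Ĥ⁰ = 0` on `E₁`,
`exists_add_map_eq_of_mem_kernel`).
[cite: KramerTunnell1982, §6 Lemma 6.1 and its proof (p. 327), type I₀] -/
theorem exists_add_map_eq_of_good {P : (X.baseChange K).toAffine.Point}
    (hP : WeierstrassCurve.Affine.Point.map (σ : K →ₐ[E] K) P = P) :
    ∃ Q : (X.baseChange K).toAffine.Point,
      Q + WeierstrassCurve.Affine.Point.map (σ : K →ₐ[E] K) Q = P := by
  haveI : (Ek.baseChange k').IsElliptic := by infer_instance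
  rcases isIntegralPoint_or_mem_kernel (w := w) X P with hint | hker
  · -- `P` integral: reduce, Lang on the special fibre, lift
    have hfix : WeierstrassCurve.Affine.Point.map (τ : k' →ₐ[k] k')
        (reducePoint w r (Ek.baseChange k') P) = reducePoint w r (Ek.baseChange k') P := by
      rw [← reducePoint_map_eq X hσw τ r hr hrσ Ek hVt hΔ P, hP]
    obtain ⟨Rt, hRt⟩ := exists_add_map_eq_of_map_eq Ek h2 τ hτ hfix
    obtain ⟨R, hRint, hRred⟩ := exists_reducePoint_eq_of_hensel X r hr Ek hVt hΔ hhensel Rt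
    have hσRint : IsIntegralPoint w (WeierstrassCurve.Affine.Point.map (σ : K →ₐ[E] K) R) :=
      (isIntegralPoint_map_iff X hσw R).mpr hRint
    -- `ρ (R + σ R) = Rt + τ Rt = ρ P`
    have hN : reducePoint w r (Ek.baseChange k')
        (R + WeierstrassCurve.Affine.Point.map (σ : K →ₐ[E] K) R) =
        reducePoint w r (Ek.baseChange k') P := by
      rw [reducePoint_add hr hΔ hVt hRint hσRint, reducePoint_map_eq X hσw τ r hr hrσ Ek hVt hΔ R,
        hRred, hRt]
    -- if `R + σ R ∈ E₁` then `ρ P = 0`, `P = O` and `Q = O` works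
    rcases isIntegralPoint_or_mem_kernel (w := w) X
      (R + WeierstrassCurve.Affine.Point.map (σ : K →ₐ[E] K) R) with hNint | hNker
    swap
    · have hP0 : reducePoint w r (Ek.baseChange k') P = 0 := by
        rw [← hN]; exact reducePoint_eq_zero_of_mem_kernel X r Ek hNker
      have hP0' : P = 0 := (reducePoint_eq_zero_iff hr hΔ hVt hint).mp hP0
      exact ⟨0, by rw [map_zero, add_zero, hP0']⟩
    -- `D = P - (R + σ R) ∈ E₁` is `σ`-fixed, hence a norm from `E₁`
    have hD : P - (R + WeierstrassCurve.Affine.Point.map (σ : K →ₐ[E] K) R) ∈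
        kernel w (X.baseChange K) :=
      sub_mem_kernel_of_reducePoint_eq X r hr Ek hVt hΔ hint hNint hN.symm
    have hDfix : WeierstrassCurve.Affine.Point.map (σ : K →ₐ[E] K)
        (P - (R + WeierstrassCurve.Affine.Point.map (σ : K →ₐ[E] K) R)) =
        P - (R + WeierstrassCurve.Affine.Point.map (σ : K →ₐ[E] K) R) := by
      rw [map_sub, map_add, map_map_self' X hσσ, hP]
      abel
    obtain ⟨b, -, hb⟩ :=
      exists_add_map_eq_of_mem_kernel X hw hσw hσσ hπσ hπ0 hπ1 hθ hθt hdisc hD hDfix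
    refine ⟨R + b, ?_⟩
    rw [map_add]
    have e : P = (R + WeierstrassCurve.Affine.Point.map (σ : K →ₐ[E] K) R) +
        (P - (R + WeierstrassCurve.Affine.Point.map (σ : K →ₐ[E] K) R)) := by abel
    rw [e, ← hb]
    abel
  · -- `P ∈ E₁`
    obtain ⟨b, -, hb⟩ :=
      exists_add_map_eq_of_mem_kernel X hw hσw hσσ hπσ hπ0 hπ1 hθ hθt hdisc hker hP
    exact ⟨b, hb⟩

include hw hΔ hσw hσσ hπσ hπ0 hπ1 hdisc hθ hθt h2 hτ hr hrσ hVt hhensel in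
/-- **`H¹(⟨σ⟩, E(K)) = 0` for good reduction: every point killed by the norm is a coboundary.**
In the setting of `exists_add_map_eq_of_good`: every `P ∈ E(K)` with `P + σP = O` is `σQ - Q`
for some `Q ∈ E(K)` (the vanishing implicit in Kramer–Tunnell's
"`dim E(F)/NE(K) = dim H⁰(G, X)`"; Lang's theorem in Mazur's form, Invent. Math. 18 (1972) §4).
[cite: KramerTunnell1982, §6 Lemma 6.1 and its proof (p. 327), type I₀] -/
theorem exists_map_sub_eq_of_good {P : (X.baseChange K).toAffine.Point}
    (hP : P + WeierstrassCurve.Affine.Point.map (σ : K →ₐ[E] K) P = 0) :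
    ∃ Q : (X.baseChange K).toAffine.Point,
      WeierstrassCurve.Affine.Point.map (σ : K →ₐ[E] K) Q - Q = P := by
  haveI : (Ek.baseChange k').IsElliptic := by infer_instance
  rcases isIntegralPoint_or_mem_kernel (w := w) X P with hint | hker
  · have hσPint : IsIntegralPoint w (WeierstrassCurve.Affine.Point.map (σ : K →ₐ[E] K) P) :=
      (isIntegralPoint_map_iff X hσw P).mpr hint
    -- `ρ P + τ ρ P = ρ (P + σ P) = 0`
    have hsum : reducePoint w r (Ek.baseChange k') P +
        WeierstrassCurve.Affine.Point.map (τ : k' →ₐ[k] k') (reducePoint w r (Ek.baseChange k') P)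
        = 0 := by
      rw [← reducePoint_map_eq X hσw τ r hr hrσ Ek hVt hΔ P, ← reducePoint_add hr hΔ hVt hint hσPint,
        hP]
      rfl
    obtain ⟨Rt, hRt⟩ := exists_map_sub_eq_of_add_map_eq_zero Ek h2 τ hτ hsum
    obtain ⟨R, hRint, hRred⟩ := exists_reducePoint_eq_of_hensel X r hr Ek hVt hΔ hhensel Rt
    have hσRint : IsIntegralPoint w (WeierstrassCurve.Affine.Point.map (σ : K →ₐ[E] K) R) :=
      (isIntegralPoint_map_iff X hσw R).mpr hRint
    have hnRint : IsIntegralPoint w (-R) := isIntegralPoint_neg_iff.mpr hRint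
    -- `ρ (σ R - R) = τ Rt - Rt = ρ P`
    have hC : reducePoint w r (Ek.baseChange k')
        (WeierstrassCurve.Affine.Point.map (σ : K →ₐ[E] K) R - R) =
        reducePoint w r (Ek.baseChange k') P := by
      rw [sub_eq_add_neg, reducePoint_add hr hΔ hVt hσRint hnRint, reducePoint_neg hVt,
        reducePoint_map_eq X hσw τ r hr hrσ Ek hVt hΔ R, hRred, ← sub_eq_add_neg, hRt]
    rcases isIntegralPoint_or_mem_kernel (w := w) X
      (WeierstrassCurve.Affine.Point.map (σ : K →ₐ[E] K) R - R) with hCint | hCker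
    swap
    · have hP0 : reducePoint w r (Ek.baseChange k') P = 0 := by
        rw [← hC]; exact reducePoint_eq_zero_of_mem_kernel X r Ek hCker
      have hP0' : P = 0 := (reducePoint_eq_zero_iff hr hΔ hVt hint).mp hP0
      exact ⟨0, by rw [map_zero, sub_zero, hP0']⟩
    have hD : P - (WeierstrassCurve.Affine.Point.map (σ : K →ₐ[E] K) R - R) ∈
        kernel w (X.baseChange K) :=
      sub_mem_kernel_of_reducePoint_eq X r hr Ek hVt hΔ hint hCint hC.symm
    have hDsum : (P - (WeierstrassCurve.Affine.Point.map (σ : K →ₐ[E] K) R - R)) +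
        WeierstrassCurve.Affine.Point.map (σ : K →ₐ[E] K)
          (P - (WeierstrassCurve.Affine.Point.map (σ : K →ₐ[E] K) R - R)) = 0 := by
      rw [map_sub, map_sub, map_map_self' X hσσ]
      have e : P - (WeierstrassCurve.Affine.Point.map (σ : K →ₐ[E] K) R - R) +
          (WeierstrassCurve.Affine.Point.map (σ : K →ₐ[E] K) P -
            (R - WeierstrassCurve.Affine.Point.map (σ : K →ₐ[E] K) R)) =
          P + WeierstrassCurve.Affine.Point.map (σ : K →ₐ[E] K) P := by abel
      rw [e, hP]
    obtain ⟨b, -, hb⟩ :=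
      exists_map_sub_eq_of_mem_kernel X hw hσw hσσ hπσ hπ0 hπ1 hθ hθt hdisc hD hDsum
    refine ⟨R + b, ?_⟩
    rw [map_add]
    have e : P = (WeierstrassCurve.Affine.Point.map (σ : K →ₐ[E] K) R - R) +
        (P - (WeierstrassCurve.Affine.Point.map (σ : K →ₐ[E] K) R - R)) := by abel
    rw [e, ← hb]
    abel
  · obtain ⟨b, -, hb⟩ :=
      exists_map_sub_eq_of_mem_kernel X hw hσw hσσ hπσ hπ0 hπ1 hθ hθt hdisc hker hP
    exact ⟨b, hb⟩

end Main

end Literature.NumberTheory.EllipticCurves.KramerTunnell1982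

end
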